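import Literature.Computability.AlgebraicComplexity.CohnUmansFrobenius80
import Literature.RepresentationTheory.FiniteGroups.FrobeniusAbelianCharacterDegrees
import HarnessLib

/-!
# The character degrees of Cohn–Umans' order-80 Frobenius group `C₅ ⋉ 𝔽₁₆` (Prop. 7.4): `1⁵, 5³`

Topic `Literature/Computability/AlgebraicComplexity` (group-theoretic matrix multiplication), namespace
`Literature.Computability.AlgebraicComplexity.Frobenius80` (the group `Aff ≅ C₅ ⋉ 𝔽₁₆` of
`CohnUmansFrobenius80.lean`, where `CohnUmans2003_prop74 : RealizesTPP Aff 5 5 8` is proved).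

H. Cohn, C. Umans, *A group-theoretic approach to fast matrix multiplication*, FOCS 2003 = arXiv:math/0307321.
§4 (arXiv p. 6–7), after Thm. 4.1 (`(nmp)^{ω/3} ≤ Σ_i d_i^ω`) and the definition of `γ` by `|G|^{1/γ} = max_i d_i`:
"However, there exist non-abelian groups for which `α < γ` and `α < 3`; one example is the group in
Proposition 7.4 below. If we do have access to the complete set of character degrees then there is a relatively
simple condition to check to determine whether the inequality in Theorem 4.1 yields a non-trivial bound on `ω`.
The condition is that `|G|^{3/α} > Σ_i d_i³`. […] We do not have examples of groups meeting this condition."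
§7.1, Prop. 7.4 (arXiv Prop. 16, p. 9): "The group `G = C₅ ⋉ 𝔽₁₆` realizes `⟨5, 5, 8⟩`, and thus
`α(G) ≤ 3 log_{200} 80 = 2.4811…`" — "the following Frobenius group of order `80`".

I. M. Isaacs, *Character Theory of Finite Groups* (1976), Problem 2.18 (tree
`Isaacs1976_problem218_charDegreePowSum`, file `FrobeniusAbelianCharacterDegrees.lean`): for `A ◁ G` with
`C_G(a) = A` (`1 ≠ a ∈ A`) and `G/A` abelian, `G` has `|G:A|` linear characters and `(|A| − 1)/|G:A|` further
irreducible characters, all of degree `|G:A|`.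

## What is here (all proved, 0 named facts)

The hypotheses of Problem 2.18 for `G = Aff` and `A = T =` the translation subgroup `𝔽₁₆` (`rotPart`, `T`,
`card_T : |T| = 16`, `index_T : |G:T| = 5`, `quotient_T_comm`, the Frobenius condition `centralizer_eq_T` from
`act_eq_self_iff` — `ζᵏ`, `k ≠ 0`, fixes no non-zero vector, a `decide`), and the consequences:

* `charDegreePowSum_aff : Σ_{χ ∈ Irr(G)} χ(1)^s = 5 + 3·5^s` — five linear characters, three of degree `5`;
* `charDegree_aff` — every irreducible character has degree `1` or `5`; in particular `d_max = 5 < 200^{1/3}`,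
  which is Cohn–Umans' "`α < γ`" for this group (`|G|^{1/α} = 200^{1/3}` by Prop. 7.4);
* `charDegreePowSum_aff_three : Σ d_i³ = 380` and `volume_558_lt_charDegreePowSum_aff_three : 5·5·8 < Σ d_i³` —
  the printed condition `|G|^{3/α} > Σ d_i³` FAILS for this group (`200 < 380`), consistent with "We do not have
  examples of groups meeting this condition": the realization `⟨5, 5, 8⟩` of Prop. 7.4 yields no bound on `ω`
  through Thm. 4.1 (the census's "no beating of the sum of cubes").

## References
* H. Cohn, C. Umans, FOCS 2003, 438–449; arXiv:math/0307321, §4 (p. 6–7), §7.1 Prop. 7.4 (arXiv Prop. 16,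
  p. 9). [CohnUmans2003]
* I. M. Isaacs, *Character Theory of Finite Groups*, Academic Press 1976, Problem 2.18. [Isaacs1976]
-/

noncomputable section

namespace Literature.Computability.AlgebraicComplexity

namespace Frobenius80

open Literature.RepresentationTheory.FiniteGroups

/-- The projection `(α, x) ↦ α` of `G = C₅ ⋉ 𝔽₁₆` onto `C₅` (rotation exponent `k ↦ ζᵏ`).
[cite: CohnUmans2003, Prop. 7.4 (setting: "semidirect product C₅ ⋉ 𝔽₁₆")] -/
def rotPart : Aff →* Multiplicative (ZMod 5) where
  toFun g := Multiplicative.ofAdd g.k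
  map_one' := by simp
  map_mul' g h := by simp [ofAdd_add]

/-- The translation subgroup `T = {(1, x) : x ∈ 𝔽₁₆} ≅ 𝔽₁₆` (the Frobenius kernel), as the kernel of `rotPart`.
[cite: CohnUmans2003, Prop. 7.4 (setting)] -/
def T : Subgroup Aff := rotPart.ker

/-- `g ∈ T ↔` its rotation part is trivial. [cite: CohnUmans2003, Prop. 7.4 (setting)] -/
theorem mem_T {g : Aff} : g ∈ T ↔ g.k = 0 := by
  simp [T, rotPart, MonoidHom.mem_ker]

/-- `T ◁ G`. [cite: CohnUmans2003, Prop. 7.4 (setting)] -/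
instance T_normal : T.Normal := by unfold T; infer_instance

/-- `G/T ≅ C₅` is abelian (`G' ≤ T = ker rotPart`). [cite: CohnUmans2003, Prop. 7.4 (setting)] -/
instance quotient_T_comm : IsMulCommutative (Aff ⧸ T) :=
  Subgroup.Normal.quotient_commutative_iff_commutator_le.mpr (Abelianization.commutator_subset_ker rotPart)

/-- Decidable membership in `T`. [folklore] -/
instance : DecidablePred (· ∈ T) := fun g => decidable_of_iff (g.k = 0) mem_T.symm

/-- `|T| = 16`. [cite: CohnUmans2003, Prop. 7.4 (setting: "𝔽₁₆")] -/
theorem card_T : Nat.card T = 16 := by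
  rw [Nat.card_eq_fintype_card, Fintype.card_subtype]
  decide

/-- `|G : T| = 5`. [cite: CohnUmans2003, Prop. 7.4 (setting: "C₅")] -/
theorem index_T : T.index = 5 := by
  have h := T.card_mul_index
  rw [card_T, Nat.card_eq_fintype_card, Aff.card_aff] at h
  omega

/-- `T ≠ G`. [cite: CohnUmans2003, Prop. 7.4 (setting)] -/
theorem T_ne_top : T ≠ ⊤ := fun h => by
  have h5 := index_T
  rw [h, Subgroup.index_top] at h5
  exact absurd h5 (by norm_num)

/-- `ζᵏ` (`k ≠ 0`) fixes no non-zero vector of `𝔽₁₆`: `ζᵏ c = c` with `c ≠ 0` forces `k = 0` (the action of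
`C₅` on `𝔽₁₆^×` is free — "Frobenius group"). [cite: CohnUmans2003, Prop. 7.4 ("the following Frobenius group of order 80")] -/
theorem act_eq_self_iff : ∀ k : ZMod 5, ∀ c : V, c ≠ 0 → (act k c = c ↔ k = 0) := by
  unfold act
  decide +kernel

/-- **The Frobenius condition `C_G(a) = T` for `1 ≠ a ∈ T`.** [cite: CohnUmans2003, Prop. 7.4 ("Frobenius group of order 80")] -/
theorem centralizer_eq_T {a : Aff} (ha : a ∈ T) (ha1 : a ≠ 1) : Subgroup.centralizer ({a} : Set Aff) = T := by
  obtain ⟨k, c⟩ := a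
  rw [mem_T] at ha
  simp only at ha
  subst ha
  have hc : c ≠ 0 := fun h => ha1 (by subst h; rfl)
  ext g
  rw [Subgroup.mem_centralizer_iff, mem_T]
  simp only [Set.mem_singleton_iff, forall_eq]
  constructor
  · intro h
    have h2 := congrArg Aff.c h
    simp only [Aff.mul_c, act, ZMod.val_zero, Function.iterate_zero, id] at h2
    -- `h2 : g.c + c = ζ^{g.k} c + g.c`
    have h3 : mulζ^[g.k.val] c = c := by
      have := congrArg (· - g.c) h2
      simp only [add_sub_cancel_left, add_sub_cancel_right] at this
      exact this.symm
    exact (act_eq_self_iff g.k c hc).mp h3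
  · intro h
    ext1
    · simp [h]
    · simp only [Aff.mul_c, h, act, ZMod.val_zero, Function.iterate_zero, id]
      rw [add_comm]

/-- **The character degrees of the order-`80` Frobenius group `G = C₅ ⋉ 𝔽₁₆` of Cohn–Umans 2003 Prop. 7.4**
(Isaacs, Problem 2.18 with `A = T = 𝔽₁₆`, `t = 5`): `5` linear characters and `(16 − 1)/5 = 3` irreducible
characters of degree `5`, i.e. `Σ_{χ ∈ Irr(G)} χ(1)^s = 5 + 3·5^s` for every real `s`.  Cohn–Umans (§4, p. 7 of
the arXiv text) cite this group as their example of a non-abelian group with `α < γ` and `α < 3`: its largest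
degree `5` is `< |G|^{1/α} = 200^{1/3}`. [cite: CohnUmans2003, §4 (remark before Question 4.1: "one example is
the group in Proposition 7.4")] [cite: Isaacs1976, Problem 2.18] -/
theorem charDegreePowSum_aff (s : ℝ) : charDegreePowSum Aff s = 5 + 3 * (5 : ℝ) ^ s := by
  rw [Isaacs1976_problem218_charDegreePowSum T (fun a ha ha1 => centralizer_eq_T ha ha1) T_ne_top s, index_T,
    card_T]
  norm_num

/-- Every irreducible character of `G = C₅ ⋉ 𝔽₁₆` has degree `1` or `5` (so `d_max = 5 < 200^{1/3} = |G|^{1/α}`,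
Cohn–Umans' "`α < γ`"). [cite: CohnUmans2003, §4 (remark: "one example is the group in Proposition 7.4")]
[cite: Isaacs1976, Problem 2.18] -/
theorem charDegree_aff {χ : Aff → ℂ} (hχ : IsIrrChar Aff χ) : χ 1 = 1 ∨ χ 1 = 5 := by
  have h := Isaacs1976_problem218_degree T (fun a ha ha1 => centralizer_eq_T ha ha1) T_ne_top hχ
  rwa [index_T, Nat.cast_ofNat] at h

/-- `Σ_i d_i³ = 380` for `G = C₅ ⋉ 𝔽₁₆`. [cite: CohnUmans2003, §4 (the condition `|G|^{3/α} > Σ d_i³`)]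
[cite: Isaacs1976, Problem 2.18] -/
theorem charDegreePowSum_aff_three : charDegreePowSum Aff 3 = 380 := by
  rw [show (3 : ℝ) = ((3 : ℕ) : ℝ) by norm_num, charDegreePowSum_aff, Real.rpow_natCast]
  norm_num

/-- **No beating of the sum of cubes by `⟨5, 5, 8⟩` in `C₅ ⋉ 𝔽₁₆`**: `5·5·8 = 200 = |G|^{3/α} < 380 = Σ d_i³`,
so Thm. 4.1 (`(nmp)^{ω/3} ≤ Σ d_i^ω`) with this realization "gives no information about `ω`" — Cohn–Umans §4:
the inequality is informative only if `|G|^{3/α} > Σ_i d_i³`, and "We do not have examples of groups meeting this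
condition." [cite: CohnUmans2003, §4 (arXiv p. 7: "The condition is that |G|^{3/α} > Σ_i d_i³ … We do not have
examples of groups meeting this condition")] -/
theorem volume_558_lt_charDegreePowSum_aff_three : (5 * 5 * 8 : ℝ) < charDegreePowSum Aff 3 := by
  rw [charDegreePowSum_aff_three]; norm_num

end Frobenius80

end Literature.Computability.AlgebraicComplexity

end
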